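import Summits.QuantumFields.YangMills.Theorems.BalabanUVNodesSpineReadingOfRecord13CoPHK
import Literature.MathematicalPhysics.QuantumFieldTheory.Balaban1983to89.Node00.Record13SepCoPHV
import Summits.QuantumFields.YangMills.Theorems.BalabanUVNodesN21StepWeightsPositivity

/-!
# THE EXTRACTION FACE OF THE SPINE READING OF RECORD AT DEF-1's VERSION SLOT — E1 ∕ E2 for `crOfRecord₁₃VAt` (and for the keyed-dial edition `crOfRecord₁₃KAt`) with the
# partition functions read at the SLOT datum `Node00.datumOfRecord₁₃SepCoPHV F N θ h v` of a revision `v : Node00.Revision₁₃ F N θ h`: the slot's Wilson schemes ARE the record's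
# (`Node00.scheme_datumOfRecord₁₃SepCoPHV`, `rfl`), so the theorems of the V ∕ K editions re-issue VERBATIM at every slot

Cell `pub-ymgap`, YM-PLAN Track A (HUMAN RULING D-0062; width push D-0149); seat `pub-ymgap-dag-n20-d` (R134 (a) N20 NE7b s3 = the U5d ∕ `crOfRecord₁₃` lineage; plan g78
WORD-CR13 «`crOfRecord₁₃` has ONE declarer = dag-n20-d») gen 29.  `--kind proof --supports <K3 key> --as helper`; THEOREMS ONLY (0 def); COUNT-NEUTRAL.
WHY.  Route rev 28 (plan g85) re-keys K3 at DEF-1's VERSION SLOT: K3⁸ `SpineGivenEndpointR13SepCoPHV` (stmt-QuantumFields-27366), skeleton v6 b4e55110ab73e679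
(`HOME/pub-ymgap-plan/D85-REV28/k3v6/K3Skeleton13SepCoPHv6.lean`), whose stub 2 `stub_expansion13HV` keeps `PinnedAtLive jc sh cr` at `crOfRecord₁₃V` and asks the extraction face
in the slot-keyed form `KeyedExtractionV cr` — E1 ∕ E2 against `(datumOfRecord₁₃SepCoPHV F 2 θ h v).scheme g₀` at the reading `cr F θ h.toCore g₀ os`; its docstring: «dag-n20-d's
`keyedExtraction_crOfRecord₁₃VAt` re-issues at the slot with its proof if it does not read (B) pointwise».  It does not read (B) (it is `ForSmallCouplings.of_forall`), so here is the
re-issue, per tuple and per slot, for the pinned V edition (§1) and for the keyed-dial K edition at ANY dial (§2), under the V edition's displayed hypotheses `hsel hU hζm hζ0`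
VERBATIM; the door `v := Revision₁₃.refl` gives back the separated-key statements.  Nothing else of the skeleton is touched (the `KeyedExtractionV` wrapper, the live∕off-live
split and the composition are the consumers' ∕ the plan's).
HONEST FRAMING.  Bookkeeping (`rfl` on the slot's schemes + the V ∕ K editions' E1 ∕ E2); NO estimate; nothing of Bałaban's asserted; NE7 ∕ NE7b ∕ NE7c NOT PRINTED for d = 4 ∕
NOT proved; no `Provisos₁₃SepCoPH` inhabitant or revision claimed (K0 open); no stub of K3⁸ closed or claimed; N19 ∕ N20 ∕ N21 ∕ N27 NOT discharged; counts UNMOVED (typed 28∕28 ·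
discharged 5∕27); one finite four-torus programme at fixed `ε` — NOT ℝ⁴, NOT OS, NOT a mass gap, NOT the Clay problem.  No decl below carries a cite tag.

v1.1 (gen 30, APPEND-ONLY; §1–§2 byte-identical; one import added — dag-n21-d's `…N21StepWeightsPositivity`, which imports `Node00.StepWeightsOfRecord` only; answers referee
ref-J READ-268).  §3 «(H-U) AND (ζ ≥ 0) SUPPLIED — E1 ∕ E2 FROM THE KEYED LIVE LINE»: of the four displayed hypotheses `hsel hU hζm hζ0` of every extraction identity of this lineage,
TWO are THEOREMS at a Stage-13 tuple with core provisos — `hU : LocalBgMeasurable F N θ.ν` is node K0c's `Node00.localBgMeasurable F N ν` (`Node00/Record12MeasurabilityAbsolute.lean`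
§1: def-R's (2.12) solution map of record is measurable, hence every (2.16) local background is; EVERY numerics `ν`), and `hζ0 : 0 ≤ θ.ζ …` follows from the rows `zetaUnity` ∕
`zetaAbs` of `hP : θ.Provisos₁₃CoPH` by dag-n21-d's `zetaOfRecord_nonneg` (`Σ ζ = 1` and `Σ |ζ| ≤ 1` force `ζ ≥ 0`) — so E1 ∕ E2 are re-issued with both DISCHARGED, under the
live-selector pin `hsel` and the joint measurability `hζm : ZetaMeasurable F N θ.ζ` ONLY, i.e. under exactly the keyed live line `LiveSel ∧ ZetaMeasurable` the stub-2 consumers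
display (dag-n14-w2 FILE 9 `keyedExtractionBFree_crOfRecord₁₃V_of_liveLine`, dag-n20-w3 13U): the workhorses `schemeZ_eq_sum_classSet_weightA_abs` ∕
`schemeZ_succ_eq_sum_classSet_weightB_abs` (base edition `…CoPH` §5), then `keyedExtraction_crOfRecord₁₃At_abs` (base), `…VAt_abs` (V edition), `…KAt_abs` (K edition, any
dial), `…VAt_slot_abs` ∕ `…KAt_slot_abs` (§1 ∕ §2 here, DEF-1's version slot).  (`hζm` is NOT a row of `Provisos₁₃CoPH` and stays displayed; for a field-constant residual it is
`Node00.zetaMeasurable_of_const`.)  READ-268 N1: the door `keyedExtraction_crOfRecord₁₃VAt_slot_refl` is STATED directly at the separated-key datum `datumOfRecord₁₃SepCoPH F N θ h`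
and proved by the V edition's theorem — `Node00.datumOfRecord₁₃SepCoPHV_refl` is the definitional reason the slot datum at `Revision₁₃.refl` is that datum, not a proof step; N3:
the bad-key reading `bd` is idle in E1 ∕ E2 by design (the K edition's totals are dial- and bad-reading-invariant, `sum_weightAK₁₃_eq` ∕ `sum_weightBK₁₃_eq`) — displayed because
the READING carries it.  Same HONEST FRAMING: two displayed hypotheses discharged by LANDED theorems; no estimate; nothing of Bałaban's asserted; no count moves.

v1.2 (gen 31, APPEND-ONLY; §1–§3 byte-identical; NO new import).  §4 «(H-ζ) SUPPLIED TOO — E1 ∕ E2 FROM THE KEYED LIVE LINE UNDER `hsel` ONLY»: since v1.1 the joint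
measurability `ZetaMeasurable F N θ.ζ` has become a ROW of every Stage-13 proviso edition (director-ym №228 R2, node00-def-RR-2's (H-ζ) train: field `zetaMeas` of
`Node00.Stage13HParams.Provisos₁₃CoPH` (`Node00/Record13CoPH.lean` :445) ∕ `…Provisos₁₃SepCoPH` (`Node00/Record13SepCoPH.lean` :121), readers `h.zetaMeas`;
[III] (3.16) p.268 bookkeeping) — so the last displayed law `hζm` of the seven §3 faces is READ OFF THE PROVISOS
ALREADY IN SCOPE (`hP.zetaMeas`, resp. `h.zetaMeas` at the version slot), and every extraction identity of this lineage (base `crOfRecord₁₃At`, V `crOfRecord₁₃VAt`, K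
`crOfRecord₁₃KAt` at any dial, and both at DEF-1's version slot) is available under the live-selector pin `hsel` ALONE: `schemeZ_eq_sum_classSet_weightA_selOnly` ∕
`schemeZ_succ_eq_sum_classSet_weightB_selOnly`, `keyedExtraction_crOfRecord₁₃At_selOnly` ∕ `…VAt_selOnly` ∕ `…KAt_selOnly` ∕ `…VAt_slot_selOnly` ∕ `…KAt_slot_selOnly` — each the
§3 lemma with `hζm := hP.zetaMeas`.  (v1.1's parenthesis «`hζm` is NOT a row of `Provisos₁₃CoPH` and stays displayed» is SUPERSEDED by that row; the §3 statements stay as the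
row-free forms for a residual supplied otherwise.)  `hsel` itself stays displayed: it is the route's guard conjunct (`LiveSel`, read by the consumers as `hG.2`), not a proviso
row.  Same HONEST FRAMING: one displayed hypothesis discharged by a LANDED proviso row; no estimate; nothing of Bałaban's asserted; no count moves.
-/

noncomputable section

open scoped BigOperators
open Finset

namespace YMDAG.UVSplit

open Literature.MathematicalPhysics.QuantumFieldTheory.Balaban1983to89
open Literature.MathematicalPhysics.QuantumFieldTheory.Balaban1983to89.T4Continuum
open Literature.MathematicalPhysics.QuantumFieldTheory.Balaban1983to89.Node00
open T4ContinuumYM4Torus (ForSmallCouplings)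

variable {F : T4Family} {N : ℕ} [NeZero N]

/-! ## §1 The pinned V edition at the slot -/

section PinnedSlot

variable (K₀ : ℕ) (jcut : ℕ → ℕ) (sh : ShellSplit₁₃CoPH N K₀) (θ : Stage13HParams F N) (h : θ.Provisos₁₃SepCoPH F N) (v : Revision₁₃ F N θ h) (E : B12.RunParams → ℝ)

/-- ★★ **E1 ∕ E2 OF `crOfRecord₁₃VAt` AT THE VERSION SLOT `v`**: `0 < l₀`, `0 < vol`, and the two runs' partition functions OF THE SLOT DATUM are the totals of the reading's class
weights — for EVERY `g₀` (a fortiori `ForSmallCouplings` at the slot datum), under the live-selector pin and B‴'s three laws, exactly as the V edition's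
`keyedExtraction_crOfRecord₁₃VAt`; the slot's schemes are the record's by `Node00.scheme_datumOfRecord₁₃SepCoPHV`. [bookkeeping] -/
theorem keyedExtraction_crOfRecord₁₃VAt_slot (hsel : θ.ppSel = ppSelLiveOfRecord F N θ.ν θ.τ9 E (wOfRecord₉ F N θ.toStage9Params))
    (hU : LocalBgMeasurable F N θ.ν) (hζm : ZetaMeasurable F N θ.ζ) (hζ0 : ∀ p g k s Pl Ql RS U V', 0 ≤ θ.ζ p g k s Pl Ql RS U V') :
    ForSmallCouplings (datumOfRecord₁₃SepCoPHV F N θ h v) fun g₀ => ∀ os : List (ULoop F),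
      0 < (crOfRecord₁₃VAt K₀ jcut sh F θ h.toCore g₀ os).l₀ ∧ 0 < (crOfRecord₁₃VAt K₀ jcut sh F θ h.toCore g₀ os).vol ∧
      (∀ (K : ℕ) (t : ℝ), |t| ≤ (crOfRecord₁₃VAt K₀ jcut sh F θ h.toCore g₀ os).l₀ →
        T4GenFunBounds.schemeZ ((datumOfRecord₁₃SepCoPHV F N θ h v).scheme g₀) os ((crOfRecord₁₃VAt K₀ jcut sh F θ h.toCore g₀ os).K₀ + K) t =
          ∑ τ ∈ (crOfRecord₁₃VAt K₀ jcut sh F θ h.toCore g₀ os).T K, (crOfRecord₁₃VAt K₀ jcut sh F θ h.toCore g₀ os).A K t τ) ∧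
      (∀ (K : ℕ) (t : ℝ), |t| ≤ (crOfRecord₁₃VAt K₀ jcut sh F θ h.toCore g₀ os).l₀ →
        T4GenFunBounds.schemeZ ((datumOfRecord₁₃SepCoPHV F N θ h v).scheme g₀) os ((crOfRecord₁₃VAt K₀ jcut sh F θ h.toCore g₀ os).K₀ + K + 1) t =
          ∑ τ ∈ (crOfRecord₁₃VAt K₀ jcut sh F θ h.toCore g₀ os).T K, (crOfRecord₁₃VAt K₀ jcut sh F θ h.toCore g₀ os).B K t τ) :=
  ForSmallCouplings.of_forall fun g₀ os =>
    ⟨one_pos, pow_pos F.side_pos 4,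
      fun K t _ => by
        rw [scheme_datumOfRecord₁₃SepCoPHV]
        exact schemeZ_eq_sum_classSet_weightA K₀ θ h.toCore E hsel hU hζm hζ0 g₀ os K t,
      fun K t _ => by
        rw [scheme_datumOfRecord₁₃SepCoPHV]
        exact schemeZ_succ_eq_sum_classSet_weightB K₀ θ h.toCore E hsel hU hζm hζ0 g₀ os K t⟩

/-- The door `v := Revision₁₃.refl`: at the trivial revision the slot statement is the V edition's statement on the separated-provisos key (the datum is then
`datumOfRecord₁₃SepCoPH F N θ h`, `Node00.datumOfRecord₁₃SepCoPHV_refl`). [bookkeeping] -/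
theorem keyedExtraction_crOfRecord₁₃VAt_slot_refl (hsel : θ.ppSel = ppSelLiveOfRecord F N θ.ν θ.τ9 E (wOfRecord₉ F N θ.toStage9Params))
    (hU : LocalBgMeasurable F N θ.ν) (hζm : ZetaMeasurable F N θ.ζ) (hζ0 : ∀ p g k s Pl Ql RS U V', 0 ≤ θ.ζ p g k s Pl Ql RS U V') :
    ForSmallCouplings (datumOfRecord₁₃SepCoPH F N θ h) fun g₀ => ∀ os : List (ULoop F),
      0 < (crOfRecord₁₃VAt K₀ jcut sh F θ h.toCore g₀ os).l₀ ∧ 0 < (crOfRecord₁₃VAt K₀ jcut sh F θ h.toCore g₀ os).vol ∧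
      (∀ (K : ℕ) (t : ℝ), |t| ≤ (crOfRecord₁₃VAt K₀ jcut sh F θ h.toCore g₀ os).l₀ →
        T4GenFunBounds.schemeZ ((datumOfRecord₁₃SepCoPH F N θ h).scheme g₀) os ((crOfRecord₁₃VAt K₀ jcut sh F θ h.toCore g₀ os).K₀ + K) t =
          ∑ τ ∈ (crOfRecord₁₃VAt K₀ jcut sh F θ h.toCore g₀ os).T K, (crOfRecord₁₃VAt K₀ jcut sh F θ h.toCore g₀ os).A K t τ) ∧
      (∀ (K : ℕ) (t : ℝ), |t| ≤ (crOfRecord₁₃VAt K₀ jcut sh F θ h.toCore g₀ os).l₀ →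
        T4GenFunBounds.schemeZ ((datumOfRecord₁₃SepCoPH F N θ h).scheme g₀) os ((crOfRecord₁₃VAt K₀ jcut sh F θ h.toCore g₀ os).K₀ + K + 1) t =
          ∑ τ ∈ (crOfRecord₁₃VAt K₀ jcut sh F θ h.toCore g₀ os).T K, (crOfRecord₁₃VAt K₀ jcut sh F θ h.toCore g₀ os).B K t τ) :=
  keyedExtraction_crOfRecord₁₃VAt K₀ jcut sh θ h.toCore E hsel hU hζm hζ0

end PinnedSlot

/-! ## §2 The keyed-dial K edition at the slot (any dial) -/

section DialSlot

variable (K₀ : ℕ) (kr : KeyReading₁₃ N K₀) (bd : BadKeyReading₁₃ N K₀) (sh : ShellSplit₁₃CoPH N K₀) (θ : Stage13HParams F N) (h : θ.Provisos₁₃SepCoPH F N)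
  (v : Revision₁₃ F N θ h) (E : B12.RunParams → ℝ)

/-- ★★ **E1 ∕ E2 OF `crOfRecord₁₃KAt K₀ kr bd sh` AT THE VERSION SLOT `v`**, for EVERY dial `kr` and bad-key reading `bd` (re-keying preserves the totals; the slot's schemes are the
record's). [bookkeeping] -/
theorem keyedExtraction_crOfRecord₁₃KAt_slot (hsel : θ.ppSel = ppSelLiveOfRecord F N θ.ν θ.τ9 E (wOfRecord₉ F N θ.toStage9Params))
    (hU : LocalBgMeasurable F N θ.ν) (hζm : ZetaMeasurable F N θ.ζ) (hζ0 : ∀ p g k s Pl Ql RS U V', 0 ≤ θ.ζ p g k s Pl Ql RS U V') :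
    ForSmallCouplings (datumOfRecord₁₃SepCoPHV F N θ h v) fun g₀ => ∀ os : List (ULoop F),
      0 < (crOfRecord₁₃KAt K₀ kr bd sh F θ h.toCore g₀ os).l₀ ∧ 0 < (crOfRecord₁₃KAt K₀ kr bd sh F θ h.toCore g₀ os).vol ∧
      (∀ (K : ℕ) (t : ℝ), |t| ≤ (crOfRecord₁₃KAt K₀ kr bd sh F θ h.toCore g₀ os).l₀ →
        T4GenFunBounds.schemeZ ((datumOfRecord₁₃SepCoPHV F N θ h v).scheme g₀) os ((crOfRecord₁₃KAt K₀ kr bd sh F θ h.toCore g₀ os).K₀ + K) t =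
          ∑ τ ∈ (crOfRecord₁₃KAt K₀ kr bd sh F θ h.toCore g₀ os).T K, (crOfRecord₁₃KAt K₀ kr bd sh F θ h.toCore g₀ os).A K t τ) ∧
      (∀ (K : ℕ) (t : ℝ), |t| ≤ (crOfRecord₁₃KAt K₀ kr bd sh F θ h.toCore g₀ os).l₀ →
        T4GenFunBounds.schemeZ ((datumOfRecord₁₃SepCoPHV F N θ h v).scheme g₀) os ((crOfRecord₁₃KAt K₀ kr bd sh F θ h.toCore g₀ os).K₀ + K + 1) t =
          ∑ τ ∈ (crOfRecord₁₃KAt K₀ kr bd sh F θ h.toCore g₀ os).T K, (crOfRecord₁₃KAt K₀ kr bd sh F θ h.toCore g₀ os).B K t τ) :=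
  ForSmallCouplings.of_forall fun g₀ os =>
    ⟨one_pos, pow_pos F.side_pos 4,
      fun K t _ => by
        rw [scheme_datumOfRecord₁₃SepCoPHV]
        exact (schemeZ_eq_sum_classSet_weightA K₀ θ h.toCore E hsel hU hζm hζ0 g₀ os K t).trans
          (sum_weightAK₁₃_eq θ h.toCore K₀ g₀ os (kr F θ h.toCore g₀ os) K t).symm,
      fun K t _ => by
        rw [scheme_datumOfRecord₁₃SepCoPHV]
        exact (schemeZ_succ_eq_sum_classSet_weightB K₀ θ h.toCore E hsel hU hζm hζ0 g₀ os K t).trans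
          (sum_weightBK₁₃_eq θ h.toCore K₀ g₀ os (kr F θ h.toCore g₀ os) K t).symm⟩

end DialSlot

/-! ## §3 (v1.1) (H-U) AND (ζ ≥ 0) SUPPLIED — E1 ∕ E2 from the keyed live line `hsel` ∧ `hζm` (`hU := Node00.localBgMeasurable F N θ.ν`, `hζ0` from `zetaUnity` ∕ `zetaAbs`) -/

section HUSupplied

open Summit.QuantumFields.YangMills.Theorems.N21StepWeightsPositivity (zetaOfRecord_nonneg)

variable (K₀ : ℕ) (jcut : ℕ → ℕ) (kr : KeyReading₁₃ N K₀) (bd : BadKeyReading₁₃ N K₀) (sh : ShellSplit₁₃CoPH N K₀) (θ : Stage13HParams F N)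
  (hP : θ.Provisos₁₃CoPH F N) (h : θ.Provisos₁₃SepCoPH F N) (v : Revision₁₃ F N θ h) (E : B12.RunParams → ℝ)

/-- **E1 AT THE READING, (H-U) ∧ (ζ ≥ 0) SUPPLIED**: `schemeZ (…) os (K₀ + K) t = Σ_{x ∈ classSet₁₃ K} weightA₁₃ K t x` under the live-selector pin `hsel` and the joint measurability `hζm` ONLY —
the base edition's `schemeZ_eq_sum_classSet_weightA` with `hU := Node00.localBgMeasurable F N θ.ν` (K0c: every (2.16) local background of record is measurable) and
`hζ0 := zetaOfRecord_nonneg … hP.zetaUnity hP.zetaAbs` (dag-n21-d: `Σ ζ = 1`, `Σ |ζ| ≤ 1` force `ζ ≥ 0`). [bookkeeping] -/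
theorem schemeZ_eq_sum_classSet_weightA_abs (hsel : θ.ppSel = ppSelLiveOfRecord F N θ.ν θ.τ9 E (wOfRecord₉ F N θ.toStage9Params))
    (hζm : ZetaMeasurable F N θ.ζ) (g₀ : ℕ → ℝ) (os : List (ULoop F)) (K : ℕ) (t : ℝ) :
    T4GenFunBounds.schemeZ ((datumOfRecord₁₃CoPH F N θ hP).scheme g₀) os (K₀ + K) t = ∑ x ∈ classSet₁₃ θ K₀ g₀ K, weightA₁₃ θ hP K₀ g₀ os K t x :=
  schemeZ_eq_sum_classSet_weightA K₀ θ hP E hsel (localBgMeasurable F N θ.ν) hζm (zetaOfRecord_nonneg F N θ.ν θ.τ9.M hP.zetaUnity hP.zetaAbs) g₀ os K t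

/-- **E2 AT THE READING, (H-U) ∧ (ζ ≥ 0) SUPPLIED**: `schemeZ (…) os (K₀ + K + 1) t = Σ_{x ∈ classSet₁₃ K} weightB₁₃ K t x` — `schemeZ_succ_eq_sum_classSet_weightB` with `hU` and `hζ0` discharged.
[bookkeeping] -/
theorem schemeZ_succ_eq_sum_classSet_weightB_abs (hsel : θ.ppSel = ppSelLiveOfRecord F N θ.ν θ.τ9 E (wOfRecord₉ F N θ.toStage9Params))
    (hζm : ZetaMeasurable F N θ.ζ) (g₀ : ℕ → ℝ) (os : List (ULoop F)) (K : ℕ) (t : ℝ) :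
    T4GenFunBounds.schemeZ ((datumOfRecord₁₃CoPH F N θ hP).scheme g₀) os (K₀ + K + 1) t = ∑ x ∈ classSet₁₃ θ K₀ g₀ K, weightB₁₃ θ hP K₀ g₀ os K t x :=
  schemeZ_succ_eq_sum_classSet_weightB K₀ θ hP E hsel (localBgMeasurable F N θ.ν) hζm (zetaOfRecord_nonneg F N θ.ν θ.τ9.M hP.zetaUnity hP.zetaAbs) g₀ os K t

/-- ★★ **THE EXTRACTION FACE AT THE READING `crOfRecord₁₃At`, (H-U) ∧ (ζ ≥ 0) SUPPLIED** (base edition's `keyedExtraction_crOfRecord₁₃At` with `hU` and `hζ0` discharged). [bookkeeping] -/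
theorem keyedExtraction_crOfRecord₁₃At_abs (hsel : θ.ppSel = ppSelLiveOfRecord F N θ.ν θ.τ9 E (wOfRecord₉ F N θ.toStage9Params))
    (hζm : ZetaMeasurable F N θ.ζ) :
    ForSmallCouplings (datumOfRecord₁₃CoPH F N θ hP) fun g₀ => ∀ os : List (ULoop F),
      0 < (crOfRecord₁₃At K₀ jcut sh F θ hP g₀ os).l₀ ∧ 0 < (crOfRecord₁₃At K₀ jcut sh F θ hP g₀ os).vol ∧
      (∀ (K : ℕ) (t : ℝ), |t| ≤ (crOfRecord₁₃At K₀ jcut sh F θ hP g₀ os).l₀ →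
        T4GenFunBounds.schemeZ ((datumOfRecord₁₃CoPH F N θ hP).scheme g₀) os ((crOfRecord₁₃At K₀ jcut sh F θ hP g₀ os).K₀ + K) t =
          ∑ τ ∈ (crOfRecord₁₃At K₀ jcut sh F θ hP g₀ os).T K, (crOfRecord₁₃At K₀ jcut sh F θ hP g₀ os).A K t τ) ∧
      (∀ (K : ℕ) (t : ℝ), |t| ≤ (crOfRecord₁₃At K₀ jcut sh F θ hP g₀ os).l₀ →
        T4GenFunBounds.schemeZ ((datumOfRecord₁₃CoPH F N θ hP).scheme g₀) os ((crOfRecord₁₃At K₀ jcut sh F θ hP g₀ os).K₀ + K + 1) t =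
          ∑ τ ∈ (crOfRecord₁₃At K₀ jcut sh F θ hP g₀ os).T K, (crOfRecord₁₃At K₀ jcut sh F θ hP g₀ os).B K t τ) :=
  keyedExtraction_crOfRecord₁₃At K₀ jcut sh θ hP E hsel (localBgMeasurable F N θ.ν) hζm (zetaOfRecord_nonneg F N θ.ν θ.τ9.M hP.zetaUnity hP.zetaAbs)

/-- ★★ **THE EXTRACTION FACE AT THE PHYSICAL-VOLUME READING `crOfRecord₁₃VAt`, (H-U) ∧ (ζ ≥ 0) SUPPLIED** (V edition's `keyedExtraction_crOfRecord₁₃VAt` with `hU` and `hζ0` discharged). [bookkeeping] -/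
theorem keyedExtraction_crOfRecord₁₃VAt_abs (hsel : θ.ppSel = ppSelLiveOfRecord F N θ.ν θ.τ9 E (wOfRecord₉ F N θ.toStage9Params))
    (hζm : ZetaMeasurable F N θ.ζ) :
    ForSmallCouplings (datumOfRecord₁₃CoPH F N θ hP) fun g₀ => ∀ os : List (ULoop F),
      0 < (crOfRecord₁₃VAt K₀ jcut sh F θ hP g₀ os).l₀ ∧ 0 < (crOfRecord₁₃VAt K₀ jcut sh F θ hP g₀ os).vol ∧
      (∀ (K : ℕ) (t : ℝ), |t| ≤ (crOfRecord₁₃VAt K₀ jcut sh F θ hP g₀ os).l₀ →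
        T4GenFunBounds.schemeZ ((datumOfRecord₁₃CoPH F N θ hP).scheme g₀) os ((crOfRecord₁₃VAt K₀ jcut sh F θ hP g₀ os).K₀ + K) t =
          ∑ τ ∈ (crOfRecord₁₃VAt K₀ jcut sh F θ hP g₀ os).T K, (crOfRecord₁₃VAt K₀ jcut sh F θ hP g₀ os).A K t τ) ∧
      (∀ (K : ℕ) (t : ℝ), |t| ≤ (crOfRecord₁₃VAt K₀ jcut sh F θ hP g₀ os).l₀ →
        T4GenFunBounds.schemeZ ((datumOfRecord₁₃CoPH F N θ hP).scheme g₀) os ((crOfRecord₁₃VAt K₀ jcut sh F θ hP g₀ os).K₀ + K + 1) t =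
          ∑ τ ∈ (crOfRecord₁₃VAt K₀ jcut sh F θ hP g₀ os).T K, (crOfRecord₁₃VAt K₀ jcut sh F θ hP g₀ os).B K t τ) :=
  keyedExtraction_crOfRecord₁₃VAt K₀ jcut sh θ hP E hsel (localBgMeasurable F N θ.ν) hζm (zetaOfRecord_nonneg F N θ.ν θ.τ9.M hP.zetaUnity hP.zetaAbs)

/-- ★★ **THE EXTRACTION FACE AT EVERY KEY READING `crOfRecord₁₃KAt K₀ kr bd sh`, (H-U) ∧ (ζ ≥ 0) SUPPLIED** (K edition's `keyedExtraction_crOfRecord₁₃KAt` with `hU` and `hζ0` discharged; any dial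
`kr`, any bad-key reading `bd` — the latter idle in E1 ∕ E2 by design). [bookkeeping] -/
theorem keyedExtraction_crOfRecord₁₃KAt_abs (hsel : θ.ppSel = ppSelLiveOfRecord F N θ.ν θ.τ9 E (wOfRecord₉ F N θ.toStage9Params))
    (hζm : ZetaMeasurable F N θ.ζ) :
    ForSmallCouplings (datumOfRecord₁₃CoPH F N θ hP) fun g₀ => ∀ os : List (ULoop F),
      0 < (crOfRecord₁₃KAt K₀ kr bd sh F θ hP g₀ os).l₀ ∧ 0 < (crOfRecord₁₃KAt K₀ kr bd sh F θ hP g₀ os).vol ∧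
      (∀ (K : ℕ) (t : ℝ), |t| ≤ (crOfRecord₁₃KAt K₀ kr bd sh F θ hP g₀ os).l₀ →
        T4GenFunBounds.schemeZ ((datumOfRecord₁₃CoPH F N θ hP).scheme g₀) os ((crOfRecord₁₃KAt K₀ kr bd sh F θ hP g₀ os).K₀ + K) t =
          ∑ τ ∈ (crOfRecord₁₃KAt K₀ kr bd sh F θ hP g₀ os).T K, (crOfRecord₁₃KAt K₀ kr bd sh F θ hP g₀ os).A K t τ) ∧
      (∀ (K : ℕ) (t : ℝ), |t| ≤ (crOfRecord₁₃KAt K₀ kr bd sh F θ hP g₀ os).l₀ →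
        T4GenFunBounds.schemeZ ((datumOfRecord₁₃CoPH F N θ hP).scheme g₀) os ((crOfRecord₁₃KAt K₀ kr bd sh F θ hP g₀ os).K₀ + K + 1) t =
          ∑ τ ∈ (crOfRecord₁₃KAt K₀ kr bd sh F θ hP g₀ os).T K, (crOfRecord₁₃KAt K₀ kr bd sh F θ hP g₀ os).B K t τ) :=
  keyedExtraction_crOfRecord₁₃KAt K₀ kr bd sh θ hP E hsel (localBgMeasurable F N θ.ν) hζm (zetaOfRecord_nonneg F N θ.ν θ.τ9.M hP.zetaUnity hP.zetaAbs)

/-- ★★ **E1 ∕ E2 OF `crOfRecord₁₃VAt` AT THE VERSION SLOT `v`, (H-U) ∧ (ζ ≥ 0) SUPPLIED** (§1's `keyedExtraction_crOfRecord₁₃VAt_slot` with `hU` and `hζ0` discharged). [bookkeeping] -/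
theorem keyedExtraction_crOfRecord₁₃VAt_slot_abs (hsel : θ.ppSel = ppSelLiveOfRecord F N θ.ν θ.τ9 E (wOfRecord₉ F N θ.toStage9Params))
    (hζm : ZetaMeasurable F N θ.ζ) :
    ForSmallCouplings (datumOfRecord₁₃SepCoPHV F N θ h v) fun g₀ => ∀ os : List (ULoop F),
      0 < (crOfRecord₁₃VAt K₀ jcut sh F θ h.toCore g₀ os).l₀ ∧ 0 < (crOfRecord₁₃VAt K₀ jcut sh F θ h.toCore g₀ os).vol ∧
      (∀ (K : ℕ) (t : ℝ), |t| ≤ (crOfRecord₁₃VAt K₀ jcut sh F θ h.toCore g₀ os).l₀ →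
        T4GenFunBounds.schemeZ ((datumOfRecord₁₃SepCoPHV F N θ h v).scheme g₀) os ((crOfRecord₁₃VAt K₀ jcut sh F θ h.toCore g₀ os).K₀ + K) t =
          ∑ τ ∈ (crOfRecord₁₃VAt K₀ jcut sh F θ h.toCore g₀ os).T K, (crOfRecord₁₃VAt K₀ jcut sh F θ h.toCore g₀ os).A K t τ) ∧
      (∀ (K : ℕ) (t : ℝ), |t| ≤ (crOfRecord₁₃VAt K₀ jcut sh F θ h.toCore g₀ os).l₀ →
        T4GenFunBounds.schemeZ ((datumOfRecord₁₃SepCoPHV F N θ h v).scheme g₀) os ((crOfRecord₁₃VAt K₀ jcut sh F θ h.toCore g₀ os).K₀ + K + 1) t =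
          ∑ τ ∈ (crOfRecord₁₃VAt K₀ jcut sh F θ h.toCore g₀ os).T K, (crOfRecord₁₃VAt K₀ jcut sh F θ h.toCore g₀ os).B K t τ) :=
  keyedExtraction_crOfRecord₁₃VAt_slot K₀ jcut sh θ h v E hsel (localBgMeasurable F N θ.ν) hζm (zetaOfRecord_nonneg F N θ.ν θ.τ9.M h.toCore.zetaUnity h.toCore.zetaAbs)

/-- ★★ **E1 ∕ E2 OF `crOfRecord₁₃KAt K₀ kr bd sh` AT THE VERSION SLOT `v`, (H-U) ∧ (ζ ≥ 0) SUPPLIED** (§2's `keyedExtraction_crOfRecord₁₃KAt_slot` with `hU` and `hζ0` discharged). [bookkeeping] -/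
theorem keyedExtraction_crOfRecord₁₃KAt_slot_abs (hsel : θ.ppSel = ppSelLiveOfRecord F N θ.ν θ.τ9 E (wOfRecord₉ F N θ.toStage9Params))
    (hζm : ZetaMeasurable F N θ.ζ) :
    ForSmallCouplings (datumOfRecord₁₃SepCoPHV F N θ h v) fun g₀ => ∀ os : List (ULoop F),
      0 < (crOfRecord₁₃KAt K₀ kr bd sh F θ h.toCore g₀ os).l₀ ∧ 0 < (crOfRecord₁₃KAt K₀ kr bd sh F θ h.toCore g₀ os).vol ∧
      (∀ (K : ℕ) (t : ℝ), |t| ≤ (crOfRecord₁₃KAt K₀ kr bd sh F θ h.toCore g₀ os).l₀ →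
        T4GenFunBounds.schemeZ ((datumOfRecord₁₃SepCoPHV F N θ h v).scheme g₀) os ((crOfRecord₁₃KAt K₀ kr bd sh F θ h.toCore g₀ os).K₀ + K) t =
          ∑ τ ∈ (crOfRecord₁₃KAt K₀ kr bd sh F θ h.toCore g₀ os).T K, (crOfRecord₁₃KAt K₀ kr bd sh F θ h.toCore g₀ os).A K t τ) ∧
      (∀ (K : ℕ) (t : ℝ), |t| ≤ (crOfRecord₁₃KAt K₀ kr bd sh F θ h.toCore g₀ os).l₀ →
        T4GenFunBounds.schemeZ ((datumOfRecord₁₃SepCoPHV F N θ h v).scheme g₀) os ((crOfRecord₁₃KAt K₀ kr bd sh F θ h.toCore g₀ os).K₀ + K + 1) t =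
          ∑ τ ∈ (crOfRecord₁₃KAt K₀ kr bd sh F θ h.toCore g₀ os).T K, (crOfRecord₁₃KAt K₀ kr bd sh F θ h.toCore g₀ os).B K t τ) :=
  keyedExtraction_crOfRecord₁₃KAt_slot K₀ kr bd sh θ h v E hsel (localBgMeasurable F N θ.ν) hζm (zetaOfRecord_nonneg F N θ.ν θ.τ9.M h.toCore.zetaUnity h.toCore.zetaAbs)

end HUSupplied

/-! ## §4 (v1.2) (H-ζ) SUPPLIED TOO — E1 ∕ E2 from the keyed live line under `hsel` ONLY (`hζm := hP.zetaMeas`, the (H-ζ) ROW of the Stage-13 provisos) -/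

section SelOnly

variable (K₀ : ℕ) (jcut : ℕ → ℕ) (kr : KeyReading₁₃ N K₀) (bd : BadKeyReading₁₃ N K₀) (sh : ShellSplit₁₃CoPH N K₀) (θ : Stage13HParams F N)
  (hP : θ.Provisos₁₃CoPH F N) (h : θ.Provisos₁₃SepCoPH F N) (v : Revision₁₃ F N θ h) (E : B12.RunParams → ℝ)

/-- **E1 AT THE READING UNDER THE SELECTOR PIN ONLY**: `schemeZ (…) os (K₀ + K) t = Σ_{x ∈ classSet₁₃ K} weightA₁₃ K t x` under `hsel` ALONE — §3's
`schemeZ_eq_sum_classSet_weightA_abs` with its joint-measurability law read off the provisos, `hζm := hP.zetaMeas` (the (H-ζ) row of `Provisos₁₃CoPH`). [bookkeeping] -/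
theorem schemeZ_eq_sum_classSet_weightA_selOnly (hsel : θ.ppSel = ppSelLiveOfRecord F N θ.ν θ.τ9 E (wOfRecord₉ F N θ.toStage9Params))
    (g₀ : ℕ → ℝ) (os : List (ULoop F)) (K : ℕ) (t : ℝ) :
    T4GenFunBounds.schemeZ ((datumOfRecord₁₃CoPH F N θ hP).scheme g₀) os (K₀ + K) t = ∑ x ∈ classSet₁₃ θ K₀ g₀ K, weightA₁₃ θ hP K₀ g₀ os K t x :=
  schemeZ_eq_sum_classSet_weightA_abs K₀ θ hP E hsel hP.zetaMeas g₀ os K t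

/-- **E2 AT THE READING UNDER THE SELECTOR PIN ONLY**: `schemeZ (…) os (K₀ + K + 1) t = Σ_{x ∈ classSet₁₃ K} weightB₁₃ K t x` under `hsel` ALONE (§3's
`schemeZ_succ_eq_sum_classSet_weightB_abs` with `hζm := hP.zetaMeas`). [bookkeeping] -/
theorem schemeZ_succ_eq_sum_classSet_weightB_selOnly (hsel : θ.ppSel = ppSelLiveOfRecord F N θ.ν θ.τ9 E (wOfRecord₉ F N θ.toStage9Params))
    (g₀ : ℕ → ℝ) (os : List (ULoop F)) (K : ℕ) (t : ℝ) :
    T4GenFunBounds.schemeZ ((datumOfRecord₁₃CoPH F N θ hP).scheme g₀) os (K₀ + K + 1) t = ∑ x ∈ classSet₁₃ θ K₀ g₀ K, weightB₁₃ θ hP K₀ g₀ os K t x :=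
  schemeZ_succ_eq_sum_classSet_weightB_abs K₀ θ hP E hsel hP.zetaMeas g₀ os K t

/-- ★★ **THE EXTRACTION FACE AT THE READING `crOfRecord₁₃At` UNDER THE SELECTOR PIN ONLY** (§3's `keyedExtraction_crOfRecord₁₃At_abs` with `hζm := hP.zetaMeas`):
`0 < l₀`, `0 < vol`, E1, E2 for every `g₀` under `hsel` ALONE. [bookkeeping] -/
theorem keyedExtraction_crOfRecord₁₃At_selOnly (hsel : θ.ppSel = ppSelLiveOfRecord F N θ.ν θ.τ9 E (wOfRecord₉ F N θ.toStage9Params)) :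
    ForSmallCouplings (datumOfRecord₁₃CoPH F N θ hP) fun g₀ => ∀ os : List (ULoop F),
      0 < (crOfRecord₁₃At K₀ jcut sh F θ hP g₀ os).l₀ ∧ 0 < (crOfRecord₁₃At K₀ jcut sh F θ hP g₀ os).vol ∧
      (∀ (K : ℕ) (t : ℝ), |t| ≤ (crOfRecord₁₃At K₀ jcut sh F θ hP g₀ os).l₀ →
        T4GenFunBounds.schemeZ ((datumOfRecord₁₃CoPH F N θ hP).scheme g₀) os ((crOfRecord₁₃At K₀ jcut sh F θ hP g₀ os).K₀ + K) t =
          ∑ τ ∈ (crOfRecord₁₃At K₀ jcut sh F θ hP g₀ os).T K, (crOfRecord₁₃At K₀ jcut sh F θ hP g₀ os).A K t τ) ∧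
      (∀ (K : ℕ) (t : ℝ), |t| ≤ (crOfRecord₁₃At K₀ jcut sh F θ hP g₀ os).l₀ →
        T4GenFunBounds.schemeZ ((datumOfRecord₁₃CoPH F N θ hP).scheme g₀) os ((crOfRecord₁₃At K₀ jcut sh F θ hP g₀ os).K₀ + K + 1) t =
          ∑ τ ∈ (crOfRecord₁₃At K₀ jcut sh F θ hP g₀ os).T K, (crOfRecord₁₃At K₀ jcut sh F θ hP g₀ os).B K t τ) :=
  keyedExtraction_crOfRecord₁₃At_abs K₀ jcut sh θ hP E hsel hP.zetaMeas

/-- ★★ **THE EXTRACTION FACE AT THE PHYSICAL-VOLUME READING `crOfRecord₁₃VAt` UNDER THE SELECTOR PIN ONLY** (§3's `keyedExtraction_crOfRecord₁₃VAt_abs` with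
`hζm := hP.zetaMeas`). [bookkeeping] -/
theorem keyedExtraction_crOfRecord₁₃VAt_selOnly (hsel : θ.ppSel = ppSelLiveOfRecord F N θ.ν θ.τ9 E (wOfRecord₉ F N θ.toStage9Params)) :
    ForSmallCouplings (datumOfRecord₁₃CoPH F N θ hP) fun g₀ => ∀ os : List (ULoop F),
      0 < (crOfRecord₁₃VAt K₀ jcut sh F θ hP g₀ os).l₀ ∧ 0 < (crOfRecord₁₃VAt K₀ jcut sh F θ hP g₀ os).vol ∧
      (∀ (K : ℕ) (t : ℝ), |t| ≤ (crOfRecord₁₃VAt K₀ jcut sh F θ hP g₀ os).l₀ →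
        T4GenFunBounds.schemeZ ((datumOfRecord₁₃CoPH F N θ hP).scheme g₀) os ((crOfRecord₁₃VAt K₀ jcut sh F θ hP g₀ os).K₀ + K) t =
          ∑ τ ∈ (crOfRecord₁₃VAt K₀ jcut sh F θ hP g₀ os).T K, (crOfRecord₁₃VAt K₀ jcut sh F θ hP g₀ os).A K t τ) ∧
      (∀ (K : ℕ) (t : ℝ), |t| ≤ (crOfRecord₁₃VAt K₀ jcut sh F θ hP g₀ os).l₀ →
        T4GenFunBounds.schemeZ ((datumOfRecord₁₃CoPH F N θ hP).scheme g₀) os ((crOfRecord₁₃VAt K₀ jcut sh F θ hP g₀ os).K₀ + K + 1) t =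
          ∑ τ ∈ (crOfRecord₁₃VAt K₀ jcut sh F θ hP g₀ os).T K, (crOfRecord₁₃VAt K₀ jcut sh F θ hP g₀ os).B K t τ) :=
  keyedExtraction_crOfRecord₁₃VAt_abs K₀ jcut sh θ hP E hsel hP.zetaMeas

/-- ★★ **THE EXTRACTION FACE AT EVERY KEY READING `crOfRecord₁₃KAt K₀ kr bd sh` UNDER THE SELECTOR PIN ONLY** (§3's `keyedExtraction_crOfRecord₁₃KAt_abs` with
`hζm := hP.zetaMeas`; any dial `kr`, any bad-key reading `bd` — the latter idle in E1 ∕ E2 by design). [bookkeeping] -/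
theorem keyedExtraction_crOfRecord₁₃KAt_selOnly (hsel : θ.ppSel = ppSelLiveOfRecord F N θ.ν θ.τ9 E (wOfRecord₉ F N θ.toStage9Params)) :
    ForSmallCouplings (datumOfRecord₁₃CoPH F N θ hP) fun g₀ => ∀ os : List (ULoop F),
      0 < (crOfRecord₁₃KAt K₀ kr bd sh F θ hP g₀ os).l₀ ∧ 0 < (crOfRecord₁₃KAt K₀ kr bd sh F θ hP g₀ os).vol ∧
      (∀ (K : ℕ) (t : ℝ), |t| ≤ (crOfRecord₁₃KAt K₀ kr bd sh F θ hP g₀ os).l₀ →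
        T4GenFunBounds.schemeZ ((datumOfRecord₁₃CoPH F N θ hP).scheme g₀) os ((crOfRecord₁₃KAt K₀ kr bd sh F θ hP g₀ os).K₀ + K) t =
          ∑ τ ∈ (crOfRecord₁₃KAt K₀ kr bd sh F θ hP g₀ os).T K, (crOfRecord₁₃KAt K₀ kr bd sh F θ hP g₀ os).A K t τ) ∧
      (∀ (K : ℕ) (t : ℝ), |t| ≤ (crOfRecord₁₃KAt K₀ kr bd sh F θ hP g₀ os).l₀ →
        T4GenFunBounds.schemeZ ((datumOfRecord₁₃CoPH F N θ hP).scheme g₀) os ((crOfRecord₁₃KAt K₀ kr bd sh F θ hP g₀ os).K₀ + K + 1) t =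
          ∑ τ ∈ (crOfRecord₁₃KAt K₀ kr bd sh F θ hP g₀ os).T K, (crOfRecord₁₃KAt K₀ kr bd sh F θ hP g₀ os).B K t τ) :=
  keyedExtraction_crOfRecord₁₃KAt_abs K₀ kr bd sh θ hP E hsel hP.zetaMeas

/-- ★★ **E1 ∕ E2 OF `crOfRecord₁₃VAt` AT THE VERSION SLOT `v` UNDER THE SELECTOR PIN ONLY** (§3's `keyedExtraction_crOfRecord₁₃VAt_slot_abs` with `hζm := h.zetaMeas`,
the (H-ζ) row of the separated-range provisos `h : θ.Provisos₁₃SepCoPH F N` the slot is keyed on). [bookkeeping] -/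
theorem keyedExtraction_crOfRecord₁₃VAt_slot_selOnly (hsel : θ.ppSel = ppSelLiveOfRecord F N θ.ν θ.τ9 E (wOfRecord₉ F N θ.toStage9Params)) :
    ForSmallCouplings (datumOfRecord₁₃SepCoPHV F N θ h v) fun g₀ => ∀ os : List (ULoop F),
      0 < (crOfRecord₁₃VAt K₀ jcut sh F θ h.toCore g₀ os).l₀ ∧ 0 < (crOfRecord₁₃VAt K₀ jcut sh F θ h.toCore g₀ os).vol ∧
      (∀ (K : ℕ) (t : ℝ), |t| ≤ (crOfRecord₁₃VAt K₀ jcut sh F θ h.toCore g₀ os).l₀ →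
        T4GenFunBounds.schemeZ ((datumOfRecord₁₃SepCoPHV F N θ h v).scheme g₀) os ((crOfRecord₁₃VAt K₀ jcut sh F θ h.toCore g₀ os).K₀ + K) t =
          ∑ τ ∈ (crOfRecord₁₃VAt K₀ jcut sh F θ h.toCore g₀ os).T K, (crOfRecord₁₃VAt K₀ jcut sh F θ h.toCore g₀ os).A K t τ) ∧
      (∀ (K : ℕ) (t : ℝ), |t| ≤ (crOfRecord₁₃VAt K₀ jcut sh F θ h.toCore g₀ os).l₀ →
        T4GenFunBounds.schemeZ ((datumOfRecord₁₃SepCoPHV F N θ h v).scheme g₀) os ((crOfRecord₁₃VAt K₀ jcut sh F θ h.toCore g₀ os).K₀ + K + 1) t =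
          ∑ τ ∈ (crOfRecord₁₃VAt K₀ jcut sh F θ h.toCore g₀ os).T K, (crOfRecord₁₃VAt K₀ jcut sh F θ h.toCore g₀ os).B K t τ) :=
  keyedExtraction_crOfRecord₁₃VAt_slot_abs K₀ jcut sh θ h v E hsel h.zetaMeas

/-- ★★ **E1 ∕ E2 OF `crOfRecord₁₃KAt K₀ kr bd sh` AT THE VERSION SLOT `v` UNDER THE SELECTOR PIN ONLY** (§3's `keyedExtraction_crOfRecord₁₃KAt_slot_abs` with
`hζm := h.zetaMeas`). [bookkeeping] -/
theorem keyedExtraction_crOfRecord₁₃KAt_slot_selOnly (hsel : θ.ppSel = ppSelLiveOfRecord F N θ.ν θ.τ9 E (wOfRecord₉ F N θ.toStage9Params)) :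
    ForSmallCouplings (datumOfRecord₁₃SepCoPHV F N θ h v) fun g₀ => ∀ os : List (ULoop F),
      0 < (crOfRecord₁₃KAt K₀ kr bd sh F θ h.toCore g₀ os).l₀ ∧ 0 < (crOfRecord₁₃KAt K₀ kr bd sh F θ h.toCore g₀ os).vol ∧
      (∀ (K : ℕ) (t : ℝ), |t| ≤ (crOfRecord₁₃KAt K₀ kr bd sh F θ h.toCore g₀ os).l₀ →
        T4GenFunBounds.schemeZ ((datumOfRecord₁₃SepCoPHV F N θ h v).scheme g₀) os ((crOfRecord₁₃KAt K₀ kr bd sh F θ h.toCore g₀ os).K₀ + K) t =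
          ∑ τ ∈ (crOfRecord₁₃KAt K₀ kr bd sh F θ h.toCore g₀ os).T K, (crOfRecord₁₃KAt K₀ kr bd sh F θ h.toCore g₀ os).A K t τ) ∧
      (∀ (K : ℕ) (t : ℝ), |t| ≤ (crOfRecord₁₃KAt K₀ kr bd sh F θ h.toCore g₀ os).l₀ →
        T4GenFunBounds.schemeZ ((datumOfRecord₁₃SepCoPHV F N θ h v).scheme g₀) os ((crOfRecord₁₃KAt K₀ kr bd sh F θ h.toCore g₀ os).K₀ + K + 1) t =
          ∑ τ ∈ (crOfRecord₁₃KAt K₀ kr bd sh F θ h.toCore g₀ os).T K, (crOfRecord₁₃KAt K₀ kr bd sh F θ h.toCore g₀ os).B K t τ) :=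
  keyedExtraction_crOfRecord₁₃KAt_slot_abs K₀ kr bd sh θ h v E hsel h.zetaMeas

end SelOnly

end YMDAG.UVSplit

end
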